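import Literature.AlgebraicGeometry.Resolution.EmbeddedResolutionExcellentSurfacesSequence
import Literature.AlgebraicGeometry.Resolution.CartierDivisorControlledTransform
import Literature.AlgebraicGeometry.Resolution.ControlledTransformBaseChange
import Literature.AlgebraicGeometry.Resolution.AlterationsSemiStableResolution
import Literature.AlgebraicGeometry.Resolution.BirationalDimensionInequality
import Literature.AlgebraicGeometry.Resolution.ExcellentBlowup
import Literature.AlgebraicGeometry.Resolution.RegularBlowup
import Literature.AlgebraicGeometry.Resolution.BlowupOffCentre
import Literature.AlgebraicGeometry.Resolution.MonomialOrderReductionUnit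
import Literature.AlgebraicGeometry.Resolution.MarkedIdealsEtale
import Literature.AlgebraicGeometry.Resolution.MarkedIdealsArithmetic
import Literature.AlgebraicGeometry.Resolution.BlowupSNC
import Literature.AlgebraicGeometry.Resolution.RetractionBlowupTransform
import Literature.AlgebraicGeometry.Resolution.NormalCrossingsStrictification
import HarnessLib

/-!
# Crux `PatchingRelPerfect` (stmt-ResolutionOfSingularities-16161), chain W5.2 — TargetsF6 stage 1, T6-E1a «DIVISORIAL PRE-PHASE»:
# transporting the FLAG along a Cossart–Jannsen–Saito sequence over the bad divisorial set

[OURS · L1 W5.2 · TargetsF6 v1 c3ff68005e5acf4d §1, T6-E1a `StageOnePrephase₃` (res-type-049), brick 2/4] Fact-free; NOT statements of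
the manuscript under review; the named fact F-32bR enters only where this transport is APPLIED (brick 4).

Let `X ⊆ E` be a closed set such that the flag `𝔟 ≤ R₁` satisfies `𝔟 ⊆ 𝓘(X)²` and `R₁ ⊆ 𝓘(X)` (in the pre-phase: `X` = the union
of the BAD prime divisors, those of multiplicity `≥ 2` in `𝔟` on which `R₁` vanishes). Along ANY sequence of blowings up of
Cossart–Jannsen–Saito type over `X` (tree `IsBPermissibleSequenceB X ∅ σ X' B'`: regular centres `V(C_j) ⊇`-contained in the strict
transforms, `𝓘(cl X_j) ≤ C_j`) every centre is FLAG-PERMISSIBLE — `𝔟_j ⊆ 𝓘(cl X_j)² ⊆ C_j²`, `R₁,j ⊆ 𝓘(cl X_j) ⊆ C_j` — and the flag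
laws `𝔟_{j+1} = τᶜ(𝔟_j, 2)`, `R₁,j+1 = τᶜ(𝔟_j, 2) + τᶜ(R₁,j, 1)` PRESERVE the two containments for the new strict transform
(`τᶜ(𝓘(cl X_j), 1) ⊆ σ(𝓘(cl X_j)) ⊆ 𝓘(cl X_{j+1})` by supports, and `τᶜ(𝓘², 2) = τᶜ(𝓘, 1)²` by Cartier cancellation). The
transport also carries: `𝔟_j` effective Cartier, `𝔟_j ≤ R₁,j`, regularity / excellence / dimension / integrality / Noetherianity of
the blown-up schemes, `cl X_j ⊆ σ⁻¹X`, and — over `E ∖ X`, where every step is a local isomorphism — the stalk identifications of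
`𝔟_j`, `R₁,j` with the pulled-back `𝔟`, `R₁`. GENERIC in the sequence predicate `P` (shape of `IsFlagSeq.cons`) with a carried
prefix, as in brick 1 (…DepthFlagPrephasePeel).

* `cjs_flag_transport` — THE TRANSPORT (induction on `IsBPermissibleSequenceB`).

AI-written; AI review is weaker than expert review.

## References
* V. Cossart, U. Jannsen, S. Saito, LNM 2270 (2020), Thm. 1.4, (6.2), Def. 6.8. [CossartJannsenSaito2020]
* E. Bierstone, D. Grigoriev, P. Milman, J. Włodarczyk, arXiv:1206.3090, §3.2 Lemma 3.2.1. [BierstoneGrigorievMilmanWlodarczyk2011]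
* J. Kollár, *Lectures on Resolution of Singularities* (2007), 3.30.2. [Kollar2007]
* The Stacks Project, Tag 02OS. [StacksProject]
-/

-- `Summit.<Summit>.<Sub>.Theorems` with `Sub = Summit` (single-conjunct summit, D-0017)
set_option linter.dupNamespace false

noncomputable section

open CategoryTheory CategoryTheory.Limits AlgebraicGeometry TopologicalSpace IsLocalRing
open Literature.AlgebraicGeometry.Resolution Scheme.IdealSheafData

namespace Summit.ResolutionOfSingularities.ResolutionOfSingularities.Theorems

universe u

namespace DepthFlagCJS

variable {W W' : Scheme.{u}}

/-! ## §1 Algebra of the flag laws against the strict transform of the bad set -/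

/-- `K² ≤ K` for ideal sheaves. [folklore] -/
private theorem sq_le (K : W.IdealSheafData) : K ^ 2 ≤ K := by
  rw [pow_two]
  exact Scheme.IdealSheafData.le_def.mpr fun U => by
    rw [Scheme.IdealSheafData.ideal_mul, Pi.mul_apply]; exact Ideal.mul_le_right

/-- Squares are monotone. [folklore] -/
private theorem sq_le_sq {K L : W.IdealSheafData} (h : K ≤ L) : K ^ 2 ≤ L ^ 2 := by
  rw [pow_two, pow_two]
  exact Scheme.IdealSheafData.le_def.mpr fun U => by
    rw [Scheme.IdealSheafData.ideal_mul, Scheme.IdealSheafData.ideal_mul, Pi.mul_apply, Pi.mul_apply]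
    exact Ideal.mul_mono (h U) (h U)

/-- Controlled transforms are monotone in the ideal. [folklore] -/
private theorem controlledTransform_mono' (τ : W' ⟶ W) (C : W.IdealSheafData) {H L : W.IdealSheafData} (h : H ≤ L) (ν : ℕ) :
    controlledTransform τ C H ν ≤ controlledTransform τ C L ν :=
  colon_mono_left (Scheme.IdealSheafData.comap_mono (f := τ) h) _

/-- **`τᶜ(I², 2) = τᶜ(I, 1)²` for `I ≤ C`** along a blowing up `τ` of `C` (`I𝒪 = C𝒪 · τᶜ(I,1)`, square, cancel the Cartier `C𝒪²`).
[cite: BierstoneGrigorievMilmanWlodarczyk2011, §3.2] -/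
theorem controlledTransform_sq_two {τ : W' ⟶ W} {C I : W.IdealSheafData} (hτ : IsBlowup τ C) (hI : I ≤ C) :
    controlledTransform τ C (I ^ 2) 2 = controlledTransform τ C I 1 ^ 2 := by
  have h1 : I.comap τ = C.comap τ * controlledTransform τ C I 1 := (hτ.comap_mul_controlledTransform_one hI).symm
  have h2 : C.comap τ ^ 2 * controlledTransform τ C I 1 ^ 2 = (I ^ 2).comap τ := by
    rw [comap_pow, h1, mul_pow]
  exact colon_pow_eq_of_mul_eq hτ.isEffectiveCartier h2

/-- **The weight-one controlled transform of `𝓘(cl X')` vanishes on the new strict transform**: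
`τᶜ(𝓘(cl X'), 1) ≤ 𝓘(cl (τ⁻¹(X' ∖ V(C))))` (off the exceptional divisor the controlled transform is the total transform, so its
zero set contains `τ⁻¹(cl X' ∖ V(C))`; both sides are compared through supports, the right side being radical).
[cite: Kollar2007, 3.30.2] -/
theorem controlledTransform_one_le_vanishingIdeal [IsLocallyNoetherian W] [IsLocallyNoetherian W'] {τ : W' ⟶ W}
    {C : W.IdealSheafData} (hτ : IsBlowup τ C) (X' : Set W) :
    controlledTransform τ C (vanishingIdeal ⟨closure X', isClosed_closure⟩) 1 ≤
      vanishingIdeal ⟨closure (τ ⁻¹' (X' \ (C.support : Set W))), isClosed_closure⟩ := by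
  set I := vanishingIdeal (⟨closure X', isClosed_closure⟩ : Closeds W) with hI
  set S := controlledTransform τ C I 1 with hS
  -- `S ≤ 𝓘(Supp S)` and `Supp S ⊇ cl τ⁻¹(X' ∖ V(C))`
  have h1 : S ≤ vanishingIdeal S.support := Scheme.IdealSheafData.le_support_iff_le_vanishingIdeal.mp le_rfl
  refine h1.trans (vanishingIdeal_antimono ?_)
  change closure (τ ⁻¹' (X' \ (C.support : Set W))) ⊆ (S.support : Set W')
  refine closure_minimal ?_ S.support.isClosed
  rintro y ⟨hyX, hyC⟩
  have hyI : τ y ∈ I.support := by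
    rw [hI, ← SetLike.mem_coe, Scheme.IdealSheafData.coe_support_vanishingIdeal]
    exact subset_closure hyX
  exact (hτ.mem_support_controlledTransform_iff_of_not_mem 1 hyC).mpr hyI

/-! ## §2 The transport -/

/-- **FLAG TRANSPORT ALONG A COSSART–JANNSEN–SAITO SEQUENCE OVER THE BAD SET** (see the module docstring).
[cite: CossartJannsenSaito2020, Thm. 1.4, (6.2)] [cite: BierstoneGrigorievMilmanWlodarczyk2011, §3.2 Lemma 3.2.1] [cite: Kollar2007, 3.30.2] -/
theorem cjs_flag_transport
    (P : ∀ ⦃E' E : Scheme.{u}⦄, (E' ⟶ E) → E.IdealSheafData → E.IdealSheafData →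
      E'.IdealSheafData → E'.IdealSheafData → Prop)
    (hcons : ∀ ⦃E'' E' E : Scheme.{u}⦄ (τ : E'' ⟶ E') (ρ : E' ⟶ E) (𝔟 R₁ : E.IdealSheafData)
      (𝔟' R₁' : E'.IdealSheafData) (C : E'.IdealSheafData),
      P ρ 𝔟 R₁ 𝔟' R₁' → Scheme.IsRegular C.subscheme → 𝔟' ≤ C ^ 2 → R₁' ≤ C → IsBlowup τ C →
      P (τ ≫ ρ) 𝔟 R₁ (controlledTransform τ C 𝔟' 2) (controlledTransform τ C 𝔟' 2 ⊔ controlledTransform τ C R₁' 1))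
    {E₀ E : Scheme.{u}} [IsIntegral E] [IsNoetherian E] (hE : Scheme.IsRegular E) (hexc : Scheme.IsExcellent E)
    (hdim : topologicalKrullDim E = 3) {ρ : E ⟶ E₀} {𝔟₀ R₀ : E₀.IdealSheafData} {𝔟 R₁ : E.IdealSheafData}
    (hP : P ρ 𝔟₀ R₀ 𝔟 R₁) (h𝔟c : IsEffectiveCartier 𝔟) (hle : 𝔟 ≤ R₁)
    {X : Set E} (hXc : IsClosed X) (h𝔟X : 𝔟 ≤ vanishingIdeal ⟨X, hXc⟩ ^ 2) (hRX : R₁ ≤ vanishingIdeal ⟨X, hXc⟩) :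
    ∀ {Z' : Scheme.{u}} {σ : Z' ⟶ E} {X' B' : Set Z'}, IsBPermissibleSequenceB X (∅ : Set E) σ X' B' →
      IsIntegral Z' ∧ IsNoetherian Z' ∧ Scheme.IsRegular Z' ∧ Scheme.IsExcellent Z' ∧ topologicalKrullDim Z' = 3 ∧
      closure X' ⊆ σ ⁻¹' X ∧
      ∃ 𝔟' R₁' : Z'.IdealSheafData, P (σ ≫ ρ) 𝔟₀ R₀ 𝔟' R₁' ∧ IsEffectiveCartier 𝔟' ∧ 𝔟' ≤ R₁' ∧
        𝔟' ≤ vanishingIdeal ⟨closure X', isClosed_closure⟩ ^ 2 ∧ R₁' ≤ vanishingIdeal ⟨closure X', isClosed_closure⟩ ∧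
        (∀ y : Z', σ y ∉ X → IsIso (σ.stalkMap y) ∧ stalkIdeal 𝔟' y = stalkIdeal (𝔟.comap σ) y ∧
          stalkIdeal R₁' y = stalkIdeal (R₁.comap σ) y) := by
  intro Z' σ X' B' h
  induction h with
  | refl =>
    have hXX : (⟨closure X, isClosed_closure⟩ : Closeds E) = ⟨X, hXc⟩ := Closeds.ext hXc.closure_eq
    refine ⟨inferInstance, inferInstance, hE, hexc, hdim, by rw [hXc.closure_eq]; exact fun x hx => hx, 𝔟, R₁,
      by simpa using hP, h𝔟c, hle, by rw [hXX]; exact h𝔟X, by rw [hXX]; exact hRX, fun y _ => ⟨?_, ?_, ?_⟩⟩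
    · rw [Scheme.Hom.stalkMap_id]; exact IsIso.id _
    · rw [Scheme.IdealSheafData.comap_id]
    · rw [Scheme.IdealSheafData.comap_id]
  | @blowup Z' Z'' σ X' B' h C τ hτ hreg hsub hBsing hperm hnc ih =>
    obtain ⟨hint, hnoeth, hZ', hexc', hdim', hXsub, 𝔟₁, R₁₁, hP₁, h𝔟₁c, hle₁, h𝔟₁I, hR₁I, hstalk⟩ := ih
    haveI := hint
    haveI := hnoeth
    set I := vanishingIdeal (⟨closure X', isClosed_closure⟩ : Closeds Z') with hIdef
    -- flag-permissibility of the CJS centre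
    have h𝔟₁C : 𝔟₁ ≤ C ^ 2 := h𝔟₁I.trans (sq_le_sq hsub)
    have hR₁C : R₁₁ ≤ C := hR₁I.trans hsub
    -- the centre is non-zero: `𝔟₁ ≤ C²` with `𝔟₁` an effective Cartier divisor on a non-empty scheme
    have hCne : C ≠ ⊥ := by
      intro hC0
      have hC2 : C ^ 2 = ⊥ := by rw [hC0, pow_two, Scheme.IdealSheafData.mul_bot]
      have h0 : 𝔟₁ = ⊥ := le_bot_iff.mp (hC2 ▸ h𝔟₁C)
      obtain ⟨U, hxU, g, hg, hU⟩ := h𝔟₁c (Classical.arbitrary Z')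
      rw [h0, Scheme.IdealSheafData.ideal_bot, Pi.bot_apply, eq_comm, Ideal.span_singleton_eq_bot] at hU
      subst hU
      haveI : Nonempty (U : Z'.Opens) := ⟨⟨_, hxU⟩⟩
      exact zero_notMem_nonZeroDivisors hg
    haveI : IsIntegral Z'' := hτ.isIntegral hCne
    haveI : IsNoetherian Z'' := isNoetherian_of_isBlowup hτ
    have hZ'' : Scheme.IsRegular Z'' := IsBlowup.isRegular_of_isRegular_subscheme hZ' hreg hτ
    have hexc'' : Scheme.IsExcellent Z'' := hτ.isExcellent hexc'
    have hdim'' : topologicalKrullDim Z'' = 3 := by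
      haveI := hτ.isProper
      rw [← hdim']
      exact (IsModification.of_isBlowup hτ hCne).isBirational.topologicalKrullDim_eq_of_isProper
    -- the new state
    set 𝔟₂ := controlledTransform τ C 𝔟₁ 2 with h𝔟₂
    set R₁₂ := controlledTransform τ C 𝔟₁ 2 ⊔ controlledTransform τ C R₁₁ 1 with hR₁₂
    set I₂ := vanishingIdeal (⟨closure (closure (τ ⁻¹' (X' \ (C.support : Set Z')))), isClosed_closure⟩ : Closeds Z'')
      with hI₂def
    have hI₂ : I₂ = vanishingIdeal ⟨closure (τ ⁻¹' (X' \ (C.support : Set Z'))), isClosed_closure⟩ := by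
      rw [hI₂def]; congr 1; exact Closeds.ext closure_closure
    -- `τᶜ(I, 1) ≤ I₂`
    have hS : controlledTransform τ C I 1 ≤ I₂ := by
      rw [hI₂]; exact controlledTransform_one_le_vanishingIdeal hτ X'
    have h𝔟₂I : 𝔟₂ ≤ I₂ ^ 2 := by
      calc 𝔟₂ ≤ controlledTransform τ C (I ^ 2) 2 := controlledTransform_mono' τ C h𝔟₁I 2
        _ = controlledTransform τ C I 1 ^ 2 := controlledTransform_sq_two hτ hsub
        _ ≤ I₂ ^ 2 := sq_le_sq hS
    have hR₂I : R₁₂ ≤ I₂ :=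
      sup_le (h𝔟₂I.trans (sq_le I₂)) ((controlledTransform_mono' τ C hR₁I 1).trans hS)
    -- `cl X'' ⊆ (τ ≫ σ)⁻¹ X`
    have hV : (C.support : Set Z') ⊆ closure X' := by
      intro x hx
      have hx' : x ∈ ((vanishingIdeal (⟨closure X', isClosed_closure⟩ : Closeds Z')).support : Set Z') :=
        Scheme.IdealSheafData.support_antitone hsub hx
      rwa [Scheme.IdealSheafData.coe_support_vanishingIdeal] at hx'
    have hXsub₂ : closure (closure (τ ⁻¹' (X' \ (C.support : Set Z')))) ⊆ (τ ≫ σ) ⁻¹' X := by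
      rw [closure_closure]
      refine closure_minimal ?_ (hXc.preimage (τ ≫ σ).continuous)
      rintro y ⟨hyX, -⟩
      have : σ (τ y) ∈ X := hXsub (subset_closure hyX)
      simpa [Set.mem_preimage, Scheme.Hom.comp_base] using this
    refine ⟨inferInstance, inferInstance, hZ'', hexc'', hdim'', hXsub₂, 𝔟₂, R₁₂, ?_,
      hτ.isEffectiveCartier_controlledTransform_of_le_pow h𝔟₁c h𝔟₁C, le_sup_left, h𝔟₂I, hR₂I, ?_⟩
    · rw [Category.assoc]
      exact hcons τ (σ ≫ ρ) 𝔟₀ R₀ 𝔟₁ R₁₁ C hP₁ hreg h𝔟₁C hR₁C hτ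
    · -- stalks over `E ∖ X`: the step is a local isomorphism there
      intro y'' hy''
      have hyσ : σ (τ y'') ∉ X := by simpa [Scheme.Hom.comp_base] using hy''
      have hyC : τ y'' ∉ (C.support : Set Z') := fun h' => hyσ (hXsub (hV h'))
      obtain ⟨hiso, h𝔟st, hRst⟩ := hstalk (τ y'') hyσ
      haveI := hiso
      haveI := hτ.isIso_stalkMap_of_not_mem_support hyC
      refine ⟨?_, ?_, ?_⟩
      · rw [Scheme.Hom.stalkMap_comp]
        exact @IsIso.comp_isIso _ _ _ _ _ _ _ hiso (hτ.isIso_stalkMap_of_not_mem_support hyC)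
      · rw [h𝔟₂, hτ.stalkIdeal_controlledTransform_of_not_mem 𝔟₁ 2 hyC, stalkIdeal_comap_eq_map, h𝔟st,
          ← stalkIdeal_comap_eq_map, ← Scheme.IdealSheafData.comap_comp]
      · rw [hR₁₂, stalkIdeal_sup, hτ.stalkIdeal_controlledTransform_of_not_mem 𝔟₁ 2 hyC,
          hτ.stalkIdeal_controlledTransform_of_not_mem R₁₁ 1 hyC, stalkIdeal_comap_eq_map, stalkIdeal_comap_eq_map,
          ← Ideal.map_sup, sup_eq_right.mpr (stalkIdeal_mono hle₁ _), hRst, ← stalkIdeal_comap_eq_map,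
          ← Scheme.IdealSheafData.comap_comp]

end DepthFlagCJS

end Summit.ResolutionOfSingularities.ResolutionOfSingularities.Theorems

end
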